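/-
Copyright (c) 2026 the pub-hodgecm-mathlib formalisation cell (harness21).  Prover seat hodgecm-mathlib-K2E1-p13 (g4) acting for R90-TF section S8 «ContSpec-n½» (planner
R90-CS-plan (g0), HAND «KYS ROAD J2′-centre» 16:19:00Z): the CENTRE VALUE `−1` of the completed intertwining `L`-ratio `Λ_F(2z−1)∕Λ_F(2z)` at `z = ½`, and its transfer to ANY
continued scattering coordinate that equals `A(z)·Λ_F(2z−1)∕Λ_F(2z)` on the tube — the payment road for the socket `sock_S8_ext_kysCentreU2` («`M(½; χ) = −1`», [KyS] Thm. 5.1).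
-/
import Literature.NumberTheory.LFunctions.DedekindZetaFunctionalEquationProofs               -- ★ `completedDedekindZeta_one_sub_holds` (Hecke's functional equation, PROVED)
import Literature.NumberTheory.LFunctions.DedekindZetaNonvanishing                           -- ★ `tendsto_sub_one_mul_dedekindZetaCont_holds`, ★ `dedekindZetaCont_ne_zero_of_one_le_re_holds`, ★ `isDedekindZetaContinuation_dedekindZetaCont_holds`
import Summits.HodgeConjecture.HodgeConjecture.Theorems.K2E1ConvexDiffCountableConnected       -- ★ `isPreconnected_convex_diff_of_countable`, ★ `countable_of_codiscrete`
import Literature.NumberTheory.GaloisRepresentations.ArtinLFunctionContinuationFE             -- ★ `Complex.differentiableAt_Gammaℝ_of_ne_zero`, ★ `Complex.differentiableAt_Gammaℂ_of_re_pos`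
import Mathlib.Analysis.Meromorphic.NormalForm
import HarnessLib

/-!
# K2·E1 ∕ R90·S8 — `K2E1IntertwiningScalarCentreValueU2`: THE COMPLETED INTERTWINING RATIO `Λ_F(2z−1)∕Λ_F(2z)` TENDS TO `−1` AT THE CENTRE `z = ½`, AND EVERY CONTINUED
# SCATTERING COORDINATE WHICH IS `A(z)·Λ_F(2z−1)∕Λ_F(2z)` ON THE TUBE TAKES THE VALUE `−A(½)` AT `z = ½`

Cell `pub/hodgecm-mathlib`, crux h413 = `stmt-HodgeConjecture-24833`, route of record `HCCMUnconditional`; R90-TF section S8, FILE A `Cruxes/H413/Lines/R90_S8_ContSpecIndexA.lean`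
§4 socket `sock_S8_ext_kysCentreU2` («for a self-dual `χ` with `χ|C_{L⁺} = 1` the global intertwining operator of `U(1,1)_{L∕L⁺}` at `z = ½` acts by `−1`: `∑ j, qc j (1∕2) • bV j = −φ`»,
[KeysShahidi1988] Thm. 5.1 as invoked [Rogawski1990] p. 161 L27–L28).  THEOREMS ONLY (no `def`, no `instance`, no notation, no named-fact hypothesis, no `sorry`; default heartbeats);
lane `--supports stmt-HodgeConjecture-24833 --as helper` (count-neutral).  Closes no socket by itself: it is the ANALYTIC HALF of the payment (road J2′ of R90-CS-plan 16:07:49Z (3)).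

THE MATHEMATICS.  Let `F` be a number field, `Λ_F(s) = |d_F|^{s∕2} Γ_ℝ(s)^{r₁} Γ_ℂ(s)^{r₂} ζ_F(s)` its completed Dedekind zeta function (★ `Literature.NumberTheory.LFunctions.completedDedekindZeta`,
HONEST product `γ_F · ζ_F` with Mathlib's junk conventions at the integers).  On the `χ`-spherical line of the Borel Eisenstein series of `U(1,1)_{L∕L⁺}` with `χ₀ = χ|_{𝔸_{L⁺}^×} = 1`
the scattering scalar is, in E1's normalisation (`vol N(F)\N(𝔸) = 1`, exponent `z`, `ρ_B ↦ z = 1`), the COMPLETED ratio `c(z) = Λ_{L⁺}(2z−1)∕Λ_{L⁺}(2z)` (the self-dual Haar measure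
contributes `∏_v q_v^{−d_v∕2} = |d_F|^{−½}`, which is exactly `|d_F|^{(2z−1)∕2}∕|d_F|^{z}`: NO stray constant).  By Hecke's functional equation `Λ_F(1−s) = Λ_F(s)` (★ PROVED,
`completedDedekindZeta_one_sub_holds`, stated off the integers) `Λ_F(2z−1) = Λ_F(2−2z)` on the punctured disc `0 < ‖z − ½‖ < ½`, and with `g(z) := (2z−1)·Λ_F(2z) → γ_F(1)·ρ_F ≠ 0`
(★ residue `tendsto_sub_one_mul_dedekindZetaCont_holds`, Mathlib `NumberField.dedekindZeta_residue_ne_zero`) and `(2z−1)·Λ_F(2−2z) = −g(1−z) → −γ_F(1)·ρ_F` one gets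
  **`Λ_F(2z−1)∕Λ_F(2z) ⟶ −1` as `z → ½`, `z ≠ ½`**   (§2)
— the sign of [KeysShahidi1988] Thm. 5.1 ∕ [Rogawski1990] Prop. 11.2.1 (b) (`M(χ)` acts by `−1`), equivalently the classical vanishing `E(g, ½) ≡ 0` of the spherical Eisenstein series.
§3 transfers this to the E1 package currency WITHOUT any analysis left of the unitary axis: if a coordinate `qc` is analytic off a co-discrete `P`, meromorphic IN NORMAL FORM at `½`
(clause 4 of the ★ 13-clause export), and equals `A(z)·Λ_F(2z−1)∕Λ_F(2z)` on the tube `1 < Re z` for some `A` holomorphic on `{½ < Re}` with a right-limit `A(½)` at `½`, then the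
identity theorem on the preconnected `{½ < Re} ∖ (P ∪ {1})` (★ `isPreconnected_convex_diff_of_countable`) gives `qc = A·Λ_F(2·−1)∕Λ_F(2·)` there, hence `qc → −A(½)` along
`𝓝[{½ < Re}] ½`; and a function meromorphic in normal form with a finite limit along a non-trivial filter below `𝓝[≠] ½` is analytic at `½` with that value (a pole would force
`‖qc‖ → ∞`): **`qc(½) = −A(½)`**.  §4 prints the socket's conclusion `∑ j, qc j (1∕2) • bV j = −φ` from the per-coordinate letters with `A j (½) = a j`, `∑ j, a j • bV j = φ`.
HONEST SCOPE.  NOT here (the junction debt, ONE letter `hsrc` per coordinate): the tube identity «`qc_j(z) = A_j(z)·Λ_{L⁺}(2z−1)∕Λ_{L⁺}(2z)`» — on the SPHERICAL line it is road J2′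
(K2E1-p10's `K2E1ChiScatteringEulerQuotientU2` `hsrc` at `ε = χ₀ = 1` upgraded by the unramified∕archimedean∕Haar factors, E1-estate); OFF the spherical line (`dim V(χ, K′, ω) > 1`)
the normalisation `A_j(½) = a_j` is the LOCAL content of [KeysShahidi1988] (normalised local intertwining operators act by `+1` at the centre on every `K_v`-type) — not in the estate.
HONEST LABEL: HC_CM is proved only modulo the 7 printed citations (2 remaining named inputs: hLiu418 = `stmt-HodgeConjecture-24832`, h413 = `stmt-HodgeConjecture-24833`) until rung 0
closes; REL ≠ ★ ≠ BUILT; this file asserts no named fact and closes no socket; count-neutral.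

* §1 (`Γ_ℝ`, `Γ_ℂ` holomorphy from ★ `ArtinLFunctionContinuationFE`) `differentiableAt_dedekindGammaFactor_of_re_pos`, `dedekindGammaFactor_ne_zero_of_re_pos'`, `differentiableAt_completedDedekindZeta`, `completedDedekindZeta_ne_zero_of_one_le_re`,
  `differentiableOn_completedDedekindZeta_ratio` — the ratio is holomorphic on `{½ < Re} ∖ {1}`.
* §2 `eventually_two_mul_sub_one_ne_intCast`, `completedDedekindZeta_two_mul_sub_one_eq`, `tendsto_two_mul_sub_one_mul_completedDedekindZeta`, **`tendsto_completedDedekindZeta_ratio_centre`**.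
* §3 `eq_of_meromorphicNFAt_of_tendsto`, **`centreValue_eq_neg_of_tube`**.   * §4 **`sum_centreValue_smul_eq_neg`**, the spherical-line prints `centreValue_eq_neg_of_tube_const` ∕
  `sum_centreValue_smul_eq_neg_of_const` (`A ≡ a`), CM print `sum_centreValue_smul_eq_neg_cm` (`F = L⁺`).

## References
* [KeysShahidi1988] D. Keys, F. Shahidi, *Artin L-functions and normalization of intertwining operators*, Ann. Sci. ÉNS 21 (1988), Thm. 5.1.
* [Rogawski1990] J. D. Rogawski, *Automorphic Representations of Unitary Groups in Three Variables* (1990): Prop. 11.2.1 pp. 161–162 (L27–L28), §13.9 p. 229.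
* [NeukirchANT1999] J. Neukirch, *Algebraic Number Theory* (1999): Ch. VII (5.10) Corollary (functional equation), (5.11) (pole and residue at `s = 1`).
* [MoeglinWaldspurger1995] C. Mœglin, J.-L. Waldspurger, *Spectral Decomposition and Eisenstein Series* (1995): IV.1.10–IV.1.11 (continuation of `M(w, s)`, identity principle).
* [Iwaniec2002] H. Iwaniec, *Spectral Methods of Automorphic Forms* (2nd ed., 2002): Thm. 3.4 ∕ (3.26) (`φ(s) = ξ(2s−1)∕ξ(2s)`), §6.3.
-/

set_option autoImplicit false
set_option linter.dupNamespace false  -- the mandated namespace repeats the summit's segment (`HodgeConjecture.HodgeConjecture`)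

noncomputable section

open Filter Topology Set Complex NumberField NumberField.InfinitePlace Bornology
open Literature.NumberTheory.LFunctions
open Summit.HodgeConjecture.HodgeConjecture.Cruxes.H413.K2E1ConvexDiffCountableConnected (isPreconnected_convex_diff_of_countable countable_of_codiscrete)

namespace Summit.HodgeConjecture.HodgeConjecture.Cruxes.H413.K2E1IntertwiningScalarCentreValueU2

variable (F : Type) [Field F] [NumberField F]

/-! ## §1 The completed Dedekind zeta function `Λ_F = γ_F · ζ_F`: holomorphy and non-vanishing where the road needs them -/

/-- **The gamma factor `γ_F(s) = |d_F|^{s∕2} Γ_ℝ(s)^{r₁} Γ_ℂ(s)^{r₂}` is holomorphic on `0 < Re s`** (cf. the off-`−ℕ` version in `Literature…ClassGroupLFunctionLogDerivLeft`, not imported here to keep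
the import cone of the E1 estate small). [cite: NeukirchANT1999, Ch. VII (5.10) Corollary] -/
theorem differentiableAt_dedekindGammaFactor_of_re_pos {s : ℂ} (hs : 0 < s.re) : DifferentiableAt ℂ (dedekindGammaFactor F) s := by
  have hd0 : ((discr F).natAbs : ℂ) ≠ 0 := Nat.cast_ne_zero.mpr (Int.natAbs_ne_zero.mpr (discr_ne_zero F))
  have h1 : DifferentiableAt ℂ (fun z : ℂ => ((discr F).natAbs : ℂ) ^ (z / 2)) s := DifferentiableAt.const_cpow (differentiableAt_id.div_const 2) (Or.inl hd0)
  have h2 : DifferentiableAt ℂ (fun z => Gammaℝ z ^ nrRealPlaces F) s := (Complex.differentiableAt_Gammaℝ_of_ne_zero (Gammaℝ_ne_zero_of_re_pos hs)).pow _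
  have h3 : DifferentiableAt ℂ (fun z => Gammaℂ z ^ nrComplexPlaces F) s := (Complex.differentiableAt_Gammaℂ_of_re_pos hs).pow _
  have h : dedekindGammaFactor F = fun z => ((discr F).natAbs : ℂ) ^ (z / 2) * Gammaℝ z ^ nrRealPlaces F * Gammaℂ z ^ nrComplexPlaces F := rfl
  rw [h]
  exact (h1.mul h2).mul h3

/-- **The gamma factor does not vanish on `0 < Re s`** (cf. `Literature…StarkExceptionalZeroProofs.dedekindGammaFactor_ne_zero_of_re_pos`, not imported here). [cite: NeukirchANT1999, Ch. VII (5.10) Corollary] -/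
theorem dedekindGammaFactor_ne_zero_of_re_pos' {s : ℂ} (hs : 0 < s.re) : dedekindGammaFactor F s ≠ 0 := by
  have hd0 : ((discr F).natAbs : ℂ) ≠ 0 := Nat.cast_ne_zero.mpr (Int.natAbs_ne_zero.mpr (discr_ne_zero F))
  have hs1 : 0 < (s + 1).re := by simp only [add_re, one_re]; linarith
  have hC : Gammaℂ s ≠ 0 := by
    rw [← Gammaℝ_mul_Gammaℝ_add_one]
    exact mul_ne_zero (Gammaℝ_ne_zero_of_re_pos hs) (Gammaℝ_ne_zero_of_re_pos hs1)
  unfold dedekindGammaFactor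
  refine mul_ne_zero (mul_ne_zero ?_ (pow_ne_zero _ (Gammaℝ_ne_zero_of_re_pos hs))) (pow_ne_zero _ hC)
  rw [Ne, cpow_eq_zero_iff, not_and_or]
  exact Or.inl hd0

/-- **`Λ_F` is holomorphic at every `s ≠ 1` with `0 < Re s`**: `ζ_F` is holomorphic off `s = 1` (Hecke, ★ `isDedekindZetaContinuation_dedekindZetaCont_holds`) and `γ_F` on `0 < Re s`.
[cite: NeukirchANT1999, Ch. VII (5.10) Corollary] -/
theorem differentiableAt_completedDedekindZeta {s : ℂ} (hs0 : 0 < s.re) (hs1 : s ≠ 1) : DifferentiableAt ℂ (completedDedekindZeta F) s := by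
  have hcont : IsDedekindZetaContinuation F (dedekindZetaCont F) := NumberField.isDedekindZetaContinuation_dedekindZetaCont_holds F
  have hζ : DifferentiableAt ℂ (dedekindZetaCont F) s := hcont.differentiableOn.differentiableAt (isOpen_compl_singleton.mem_nhds hs1)
  have h : completedDedekindZeta F = fun z => dedekindGammaFactor F z * dedekindZetaCont F z := rfl
  rw [h]
  exact (differentiableAt_dedekindGammaFactor_of_re_pos F hs0).mul hζ

/-- **`Λ_F(s) ≠ 0` for `1 ≤ Re s`, `s ≠ 1`** (`γ_F ≠ 0` on `0 < Re s`; `ζ_F ≠ 0` there: Euler product ∕ Landau, ★ `dedekindZetaCont_ne_zero_of_one_le_re_holds`).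
[cite: NeukirchANT1999, Ch. VII (5.10) Corollary] -/
theorem completedDedekindZeta_ne_zero_of_one_le_re {s : ℂ} (hs : 1 ≤ s.re) (hs1 : s ≠ 1) : completedDedekindZeta F s ≠ 0 :=
  mul_ne_zero (dedekindGammaFactor_ne_zero_of_re_pos' F (by linarith)) (dedekindZetaCont_ne_zero_of_one_le_re_holds (K := F) hs hs1)

/-- **THE COMPLETED RATIO `z ↦ Λ_F(2z−1)∕Λ_F(2z)` IS HOLOMORPHIC ON `{½ < Re z} ∖ {1}`** — numerator holomorphic for `0 < Re(2z−1)`, `2z−1 ≠ 1`; denominator holomorphic and `≠ 0` for `1 < Re(2z)`.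
Its only singularity on the half-plane `½ < Re z` is the simple pole at `z = 1` (from `ζ_F` at `1`). [cite: Rogawski1990, §13.9 p. 229] [cite: NeukirchANT1999, Ch. VII (5.11)] -/
theorem differentiableOn_completedDedekindZeta_ratio :
    DifferentiableOn ℂ (fun z : ℂ => completedDedekindZeta F (2 * z - 1) / completedDedekindZeta F (2 * z)) ({z : ℂ | 1 / 2 < z.re} \ {1}) := by
  intro z hz
  have hz' : 1 / 2 < z.re := hz.1
  have hz1 : z ≠ 1 := fun h => hz.2 h
  have h2 : DifferentiableAt ℂ (fun w : ℂ => 2 * w) z := (differentiableAt_const _).mul differentiableAt_id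
  have h21 : DifferentiableAt ℂ (fun w : ℂ => 2 * w - 1) z := h2.sub (differentiableAt_const _)
  have hre1 : 0 < (2 * z - 1).re := by
    simp only [sub_re, mul_re, re_ofNat, im_ofNat, zero_mul, sub_zero, one_re]; linarith
  have hne1 : 2 * z - 1 ≠ 1 := by
    intro h
    apply hz1
    have : (2 : ℂ) * z = 2 := by linear_combination h
    have h2' : (2 : ℂ) ≠ 0 := two_ne_zero
    calc z = 2 * z / 2 := by field_simp
      _ = 1 := by rw [this]; norm_num
  have hre2 : 1 ≤ (2 * z).re := by
    simp only [mul_re, re_ofNat, im_ofNat, zero_mul, sub_zero]; linarith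
  have hne2 : 2 * z ≠ 1 := by
    intro h
    have : (2 * z).re = 1 := by rw [h]; simp
    simp only [mul_re, re_ofNat, im_ofNat, zero_mul, sub_zero] at this
    linarith
  have hnum := (differentiableAt_completedDedekindZeta F hre1 hne1).comp z h21
  have hden := (differentiableAt_completedDedekindZeta F (by linarith) hne2).comp z h2
  exact (hnum.div hden (completedDedekindZeta_ne_zero_of_one_le_re F hre2 hne2)).differentiableWithinAt

/-! ## §2 The centre: `Λ_F(2z−1)∕Λ_F(2z) → −1` as `z → ½` -/

/-- On the punctured disc `0 < ‖z − ½‖ < ½` (hence eventually along `𝓝[≠] ½`) the argument `2z − 1` is NOT an integer — the functional equation, stated off the integers, applies there. [folklore] -/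
theorem eventually_two_mul_sub_one_ne_intCast : ∀ᶠ z : ℂ in 𝓝[≠] (1 / 2 : ℂ), ∀ n : ℤ, 2 * z - 1 ≠ (n : ℂ) := by
  have hball : Metric.ball (1 / 2 : ℂ) (1 / 2) ∈ 𝓝 (1 / 2 : ℂ) := Metric.ball_mem_nhds _ (by norm_num)
  filter_upwards [mem_nhdsWithin_of_mem_nhds hball, self_mem_nhdsWithin] with z hz hz0
  intro n hn
  have hzn : z - 1 / 2 = (n : ℂ) / 2 := by linear_combination hn / 2
  have hnorm : ‖(n : ℂ) / 2‖ < 1 / 2 := by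
    rw [← hzn]; simpa [dist_eq_norm] using hz
  have hn1 : |(n : ℝ)| < 1 := by
    rw [norm_div, Complex.norm_intCast] at hnorm
    have : ‖(2 : ℂ)‖ = 2 := by simp
    rw [this] at hnorm
    linarith
  have hn0 : n = 0 := by
    have : |n| < 1 := by exact_mod_cast hn1
    exact Int.abs_lt_one_iff.mp this
  apply hz0
  have : z - 1 / 2 = 0 := by rw [hzn, hn0]; simp
  simpa [sub_eq_zero] using this

/-- **THE FUNCTIONAL EQUATION AT THE PAIR `(2z−1, 2−2z)`**: for `2z − 1 ∉ ℤ`, `Λ_F(2z−1) = Λ_F(2−2z)` (Hecke: `Λ_F(1−s) = Λ_F(s)` at `s = 2z−1`, ★ `completedDedekindZeta_one_sub_holds`).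
[cite: NeukirchANT1999, Ch. VII (5.10) Corollary] -/
theorem completedDedekindZeta_two_mul_sub_one_eq {z : ℂ} (hz : ∀ n : ℤ, 2 * z - 1 ≠ (n : ℂ)) :
    completedDedekindZeta F (2 * z - 1) = completedDedekindZeta F (2 - 2 * z) := by
  have h := completedDedekindZeta_one_sub_holds (K := F) hz
  rw [show (1 : ℂ) - (2 * z - 1) = 2 - 2 * z by ring] at h
  exact h.symm

/-- **`(2z−1)·Λ_F(2z) → γ_F(1)·ρ_F` as `z → ½`, `z ≠ ½`** — the simple pole of `ζ_F` at `1` (★ `tendsto_sub_one_mul_dedekindZetaCont_holds`: `(s−1)ζ_F(s) → ρ_F`) times the continuity of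
the gamma factor at `1`; the limit is `≠ 0` (`γ_F(1) ≠ 0`, `ρ_F ≠ 0`: Mathlib `NumberField.dedekindZeta_residue_ne_zero`). [cite: NeukirchANT1999, Ch. VII (5.11)] -/
theorem tendsto_two_mul_sub_one_mul_completedDedekindZeta :
    Tendsto (fun z : ℂ => (2 * z - 1) * completedDedekindZeta F (2 * z)) (𝓝[≠] (1 / 2 : ℂ))
      (𝓝 (dedekindGammaFactor F 1 * (dedekindZeta_residue F : ℂ))) ∧
    dedekindGammaFactor F 1 * (dedekindZeta_residue F : ℂ) ≠ 0 := by
  refine ⟨?_, mul_ne_zero (dedekindGammaFactor_ne_zero_of_re_pos' F (by simp)) (ofReal_ne_zero.mpr (dedekindZeta_residue_ne_zero F))⟩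
  -- `z ↦ 2z` maps `𝓝[≠] ½` into `𝓝[≠] 1`
  have h2 : Tendsto (fun z : ℂ => 2 * z) (𝓝[≠] (1 / 2 : ℂ)) (𝓝[≠] 1) := by
    refine tendsto_nhdsWithin_iff.mpr ⟨?_, ?_⟩
    · have hc : Tendsto (fun z : ℂ => 2 * z) (𝓝 (1 / 2 : ℂ)) (𝓝 (2 * (1 / 2))) := (continuous_const.mul continuous_id).tendsto _
      rw [show (2 : ℂ) * (1 / 2) = 1 by norm_num] at hc
      exact hc.mono_left nhdsWithin_le_nhds
    · filter_upwards [self_mem_nhdsWithin] with z hz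
      intro h
      apply hz
      have h' : (2 : ℂ) * z = 1 := h
      show z = 1 / 2
      linear_combination h' / 2
  have hγc : ContinuousAt (dedekindGammaFactor F) 1 := (differentiableAt_dedekindGammaFactor_of_re_pos F (by simp)).continuousAt
  have hγ : Tendsto (fun z : ℂ => dedekindGammaFactor F (2 * z)) (𝓝[≠] (1 / 2 : ℂ)) (𝓝 (dedekindGammaFactor F 1)) :=
    hγc.tendsto.comp (tendsto_nhdsWithin_iff.mp h2).1
  have hρ : Tendsto (fun s : ℂ => (s - 1) * dedekindZetaCont F s) (𝓝[≠] 1) (𝓝 (dedekindZeta_residue F : ℂ)) := tendsto_sub_one_mul_dedekindZetaCont_holds F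
  have hζ : Tendsto (fun z : ℂ => (2 * z - 1) * dedekindZetaCont F (2 * z)) (𝓝[≠] (1 / 2 : ℂ)) (𝓝 (dedekindZeta_residue F : ℂ)) := hρ.comp h2
  refine (hγ.mul hζ).congr fun z => ?_
  show dedekindGammaFactor F (2 * z) * ((2 * z - 1) * dedekindZetaCont F (2 * z)) = (2 * z - 1) * (dedekindGammaFactor F (2 * z) * dedekindZetaCont F (2 * z))
  ring

/-- **[KyS]'S SIGN FROM ★ BYTES: `Λ_F(2z−1)∕Λ_F(2z) → −1` AS `z → ½` (`z ≠ ½`).**  On the punctured disc, `Λ_F(2z−1) = Λ_F(2−2z)` (functional equation), so the ratio is `h(z)∕g(z)` with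
`g(z) = (2z−1)·Λ_F(2z) → γ_F(1)ρ_F ≠ 0` and `h(z) = (2z−1)·Λ_F(2−2z) = −g(1−z) → −γ_F(1)ρ_F`: the two simple poles of `Λ_F` at `s = 1` and (through the functional equation) at
`s = 0` have OPPOSITE residues in the variable `2z−1`.  This is the value `M(χ) = −1` of the global intertwining operator of `U(1,1)_{L∕L⁺}` at the centre for `χ|C_{L⁺} = 1` on the
spherical line ([KeysShahidi1988] Thm. 5.1; [Rogawski1990] Prop. 11.2.1 (b), p. 161 L27–L28), equivalently `E(g, ½) ≡ 0` ([Iwaniec2002] (3.26) with `φ(s) = ξ(2s−1)∕ξ(2s)`).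
[cite: KeysShahidi1988, Thm. 5.1] [cite: Rogawski1990, Prop. 11.2.1 pp. 161–162] [cite: NeukirchANT1999, Ch. VII (5.10)–(5.11)] [cite: Iwaniec2002, Thm. 3.4] -/
theorem tendsto_completedDedekindZeta_ratio_centre :
    Tendsto (fun z : ℂ => completedDedekindZeta F (2 * z - 1) / completedDedekindZeta F (2 * z)) (𝓝[≠] (1 / 2 : ℂ)) (𝓝 (-1)) := by
  obtain ⟨hg, hne⟩ := tendsto_two_mul_sub_one_mul_completedDedekindZeta F
  -- `z ↦ 1 − z` maps `𝓝[≠] ½` into itself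
  have h1 : Tendsto (fun z : ℂ => 1 - z) (𝓝[≠] (1 / 2 : ℂ)) (𝓝[≠] (1 / 2 : ℂ)) := by
    refine tendsto_nhdsWithin_iff.mpr ⟨?_, ?_⟩
    · have hc : Tendsto (fun z : ℂ => 1 - z) (𝓝 (1 / 2 : ℂ)) (𝓝 (1 - 1 / 2)) := (continuous_const.sub continuous_id).tendsto _
      rw [show (1 : ℂ) - 1 / 2 = 1 / 2 by norm_num] at hc
      exact hc.mono_left nhdsWithin_le_nhds
    · filter_upwards [self_mem_nhdsWithin] with z hz
      intro h
      apply hz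
      have h' : (1 : ℂ) - z = 1 / 2 := h
      show z = 1 / 2
      linear_combination -h'
  -- `h(z) = (2z−1)·Λ_F(2−2z) = −g(1−z) → −(γ_F(1)ρ_F)`
  have hh : Tendsto (fun z : ℂ => (2 * z - 1) * completedDedekindZeta F (2 - 2 * z)) (𝓝[≠] (1 / 2 : ℂ))
      (𝓝 (-(dedekindGammaFactor F 1 * (dedekindZeta_residue F : ℂ)))) := by
    refine (hg.comp h1).neg.congr fun z => ?_
    show -((2 * (1 - z) - 1) * completedDedekindZeta F (2 * (1 - z))) = (2 * z - 1) * completedDedekindZeta F (2 - 2 * z)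
    rw [show (2 : ℂ) * (1 - z) = 2 - 2 * z by ring]
    ring
  have hlim : Tendsto (fun z : ℂ => (2 * z - 1) * completedDedekindZeta F (2 - 2 * z) / ((2 * z - 1) * completedDedekindZeta F (2 * z))) (𝓝[≠] (1 / 2 : ℂ))
      (𝓝 (-(dedekindGammaFactor F 1 * (dedekindZeta_residue F : ℂ)) / (dedekindGammaFactor F 1 * (dedekindZeta_residue F : ℂ)))) := hh.div hg hne
  rw [neg_div, div_self hne] at hlim
  refine hlim.congr' ?_
  filter_upwards [eventually_two_mul_sub_one_ne_intCast, self_mem_nhdsWithin] with z hz hz0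
  have h2z : (2 : ℂ) * z - 1 ≠ 0 := by
    intro h
    apply hz0
    show z = 1 / 2
    linear_combination h / 2
  rw [mul_div_mul_left _ _ h2z, completedDedekindZeta_two_mul_sub_one_eq F hz]

/-! ## §3 Transfer to a continued scattering coordinate: the value AT `½` is `−A(½)` -/

/-- **A FUNCTION MEROMORPHIC IN NORMAL FORM WITH A FINITE LIMIT ALONG A NON-TRIVIAL FILTER BELOW `𝓝[≠] x` IS WORTH THAT LIMIT AT `x`.**  In normal form either `f` is analytic at `x`
(then continuity and uniqueness of limits), or `f` has a genuine pole at `x` — but then `‖f‖ → ∞` along `𝓝[≠] x` (Mathlib `tendsto_cobounded_of_meromorphicOrderAt_neg`), hence along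
`l`, contradicting the finite limit. [cite: MoeglinWaldspurger1995, IV.1.10] -/
theorem eq_of_meromorphicNFAt_of_tendsto {f : ℂ → ℂ} {x c : ℂ} {l : Filter ℂ} [l.NeBot] (hf : MeromorphicNFAt f x) (hl : l ≤ 𝓝[≠] x)
    (h : Tendsto f l (𝓝 c)) : f x = c := by
  rcases meromorphicNFAt_iff_analyticAt_or.mp hf with ha | ⟨-, hneg, -⟩
  · exact tendsto_nhds_unique (ha.continuousAt.tendsto.mono_left (hl.trans nhdsWithin_le_nhds)) h
  · exfalso
    have hcb : Tendsto f l (cobounded ℂ) := (tendsto_cobounded_of_meromorphicOrderAt_neg hneg).mono_left hl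
    rw [← tendsto_norm_atTop_iff_cobounded] at hcb
    exact not_tendsto_atTop_of_tendsto_nhds h.norm hcb

/-- **THE CENTRE VALUE OF A CONTINUED SCATTERING COORDINATE IN COMPLETED-RATIO CURRENCY.**  Let `qc : ℂ → ℂ` be analytic off a co-discrete `P` and meromorphic in normal form at `½`
(clauses 8, 11, 4 of the ★ 13-clause export `chiEisenstein_meromorphic_exports_level_cm_two`), and suppose the TUBE IDENTITY `qc z = A z · Λ_F(2z−1)∕Λ_F(2z)` for `1 < Re z`, with `A`
holomorphic on `{½ < Re}` and `A → A(½)` along `𝓝[{½ < Re}] ½`.  Then **`qc(½) = −A(½)`**.  (Identity theorem on the preconnected `{½ < Re} ∖ (P ∪ {1})`, ★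
`isPreconnected_convex_diff_of_countable` ∕ ★ `countable_of_codiscrete`; right-limit `qc → A(½)·(−1)` by §2; §3's normal-form lemma.  Nothing is used left of the unitary axis.)
[cite: KeysShahidi1988, Thm. 5.1] [cite: Rogawski1990, Prop. 11.2.1 pp. 161–162] [cite: MoeglinWaldspurger1995, IV.1.10–IV.1.11] -/
theorem centreValue_eq_neg_of_tube {qc A : ℂ → ℂ} {P : Set ℂ} (hPcd : ∀ z₀ : ℂ, ∀ᶠ s in 𝓝[≠] z₀, s ∉ P) (hqa : ∀ z : ℂ, z ∉ P → AnalyticAt ℂ qc z)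
    (hqm : MeromorphicNFAt qc (1 / 2 : ℂ)) (hAd : DifferentiableOn ℂ A {z : ℂ | 1 / 2 < z.re}) (hAc : ContinuousWithinAt A {z : ℂ | 1 / 2 < z.re} (1 / 2 : ℂ))
    (hsrc : ∀ z : ℂ, 1 < z.re → qc z = A z * (completedDedekindZeta F (2 * z - 1) / completedDedekindZeta F (2 * z))) :
    qc (1 / 2 : ℂ) = -A (1 / 2 : ℂ) := by
  -- Step A: identity theorem on `V = {½ < Re} ∖ (P ∪ {1})`
  have hHo : IsOpen {z : ℂ | 1 / 2 < z.re} := isOpen_lt continuous_const continuous_re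
  have hcount : (P ∪ {1}).Countable := (countable_of_codiscrete hPcd).union (countable_singleton 1)
  have hV : IsPreconnected ({z : ℂ | 1 / 2 < z.re} \ (P ∪ {1})) :=
    isPreconnected_convex_diff_of_countable Literature.Topology.Euclidean.one_lt_rank_real_complex (convex_halfSpace_re_gt (1 / 2)) hHo hcount
  have hqA : AnalyticOnNhd ℂ qc ({z : ℂ | 1 / 2 < z.re} \ (P ∪ {1})) := fun w hw => hqa w fun h => hw.2 (Or.inl h)
  have hUo : IsOpen ({z : ℂ | 1 / 2 < z.re} \ {1}) := hHo.sdiff isClosed_singleton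
  have hRA : AnalyticOnNhd ℂ (fun z : ℂ => completedDedekindZeta F (2 * z - 1) / completedDedekindZeta F (2 * z)) ({z : ℂ | 1 / 2 < z.re} \ {1}) :=
    (differentiableOn_completedDedekindZeta_ratio F).analyticOnNhd hUo
  have hAA : AnalyticOnNhd ℂ A {z : ℂ | 1 / 2 < z.re} := hAd.analyticOnNhd hHo
  have hARA : AnalyticOnNhd ℂ (fun z => A z * (completedDedekindZeta F (2 * z - 1) / completedDedekindZeta F (2 * z))) ({z : ℂ | 1 / 2 < z.re} \ (P ∪ {1})) :=
    fun w hw => (hAA w hw.1).mul (hRA w ⟨hw.1, fun h => hw.2 (Or.inr h)⟩)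
  -- a tube point off `P ∪ {1}`
  have hTo : IsOpen {w : ℂ | 1 < w.re} := isOpen_lt continuous_const continuous_re
  obtain ⟨z₁, hz₁t, hz₁S⟩ := (hcount.dense_compl ℂ).inter_open_nonempty _ hTo ⟨2, by simp⟩
  have hz₁t' : 1 < z₁.re := hz₁t
  have hz₁V : z₁ ∈ {z : ℂ | 1 / 2 < z.re} \ (P ∪ {1}) := ⟨show 1 / 2 < z₁.re by linarith, hz₁S⟩
  have hev : qc =ᶠ[𝓝 z₁] fun z => A z * (completedDedekindZeta F (2 * z - 1) / completedDedekindZeta F (2 * z)) := by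
    filter_upwards [hTo.mem_nhds hz₁t] with w hw using hsrc w hw
  have hEq : EqOn qc (fun z => A z * (completedDedekindZeta F (2 * z - 1) / completedDedekindZeta F (2 * z))) ({z : ℂ | 1 / 2 < z.re} \ (P ∪ {1})) :=
    hqA.eqOn_of_preconnected_of_eventuallyEq hARA hV hz₁V hev
  -- Step B: the right-limit along `ℓ = 𝓝[{½ < Re}] ½`
  haveI hne : (𝓝[{z : ℂ | 1 / 2 < z.re}] (1 / 2 : ℂ)).NeBot := by
    refine mem_closure_iff_nhdsWithin_neBot.mp ?_
    rw [closure_setOf_lt_re]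
    show (1 / 2 : ℝ) ≤ (1 / 2 : ℂ).re
    norm_num
  have hle : 𝓝[{z : ℂ | 1 / 2 < z.re}] (1 / 2 : ℂ) ≤ 𝓝[≠] (1 / 2 : ℂ) := by
    refine nhdsWithin_mono _ fun z hz => ?_
    intro h
    have hz' : 1 / 2 < z.re := hz
    rw [show z = 1 / 2 from h] at hz'
    norm_num at hz'
  have hevV : ∀ᶠ s in 𝓝[{z : ℂ | 1 / 2 < z.re}] (1 / 2 : ℂ), s ∈ {z : ℂ | 1 / 2 < z.re} \ (P ∪ {1}) := by
    have h1 : ∀ᶠ s in 𝓝[{z : ℂ | 1 / 2 < z.re}] (1 / 2 : ℂ), s ∉ P := (hPcd (1 / 2)).filter_mono hle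
    have h2 : ∀ᶠ s in 𝓝[{z : ℂ | 1 / 2 < z.re}] (1 / 2 : ℂ), s ≠ 1 :=
      mem_nhdsWithin_of_mem_nhds (isOpen_ne.mem_nhds (by norm_num : (1 / 2 : ℂ) ≠ 1))
    filter_upwards [h1, h2, self_mem_nhdsWithin] with s hs1 hs2 hs3
    exact ⟨hs3, fun h => h.elim hs1 hs2⟩
  have hlimR := (tendsto_completedDedekindZeta_ratio_centre F).mono_left hle
  have hlim : Tendsto qc (𝓝[{z : ℂ | 1 / 2 < z.re}] (1 / 2 : ℂ)) (𝓝 (A (1 / 2) * (-1))) :=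
    (hAc.tendsto.mul hlimR).congr' (hevV.mono fun s hs => (hEq hs).symm)
  -- Step C: normal form pins the value
  rw [mul_neg_one] at hlim
  exact eq_of_meromorphicNFAt_of_tendsto hqm hle hlim

/-! ## §4 The socket-currency print: `∑ j, qc j (1∕2) • bV j = −φ` -/

/-- **`M(½) = −1` IN COORDINATES — the conclusion of `sock_S8_ext_kysCentreU2`, token for token, from the per-coordinate tube letters.**  For a finite family `bV : ι′ → X` in any `ℂ`-module
(read: the coerced basis vectors `⇑(bV j) : G(𝔸) → ℂ` of `V(χʷ, K′, ω) = V(χ, K′, ω)`, `χʷ = χ`), `φ = ∑ j, a j • bV j`, and continued coordinates `qc j` analytic off co-discrete `P`,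
meromorphic in normal form at `½` (clauses 8, 11, 4 of the ★ export), with the tube identities `qc j z = A j z · Λ_F(2z−1)∕Λ_F(2z)` (`1 < Re z`), `A j` holomorphic on `{½ < Re}` with
right-limit `A j (½) = a j`:  **`∑ j, qc j (1∕2) • bV j = −φ`**.  HONEST: the letters `hsrc`∕`hAhalf` are the junction debt (road J2′ on the spherical line; [KyS]-local off it).
[cite: KeysShahidi1988, Thm. 5.1] [cite: Rogawski1990, Prop. 11.2.1 pp. 161–162; Prop. 13.6.2 (6) p. 210] -/
theorem sum_centreValue_smul_eq_neg {X : Type*} [AddCommGroup X] [Module ℂ X] {ι' : Type*} [Fintype ι'] (bV : ι' → X) {φ : X} (a : ι' → ℂ)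
    (hφ : ∑ j, a j • bV j = φ) (qc A : ι' → ℂ → ℂ) {P : Set ℂ} (hPcd : ∀ z₀ : ℂ, ∀ᶠ s in 𝓝[≠] z₀, s ∉ P)
    (hqa : ∀ j (z : ℂ), z ∉ P → AnalyticAt ℂ (qc j) z) (hqm : ∀ j, MeromorphicNFAt (qc j) (1 / 2 : ℂ))
    (hAd : ∀ j, DifferentiableOn ℂ (A j) {z : ℂ | 1 / 2 < z.re}) (hAc : ∀ j, ContinuousWithinAt (A j) {z : ℂ | 1 / 2 < z.re} (1 / 2 : ℂ)) (hAhalf : ∀ j, A j (1 / 2 : ℂ) = a j)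
    (hsrc : ∀ j (z : ℂ), 1 < z.re → qc j z = A j z * (completedDedekindZeta F (2 * z - 1) / completedDedekindZeta F (2 * z))) :
    ∑ j, qc j (1 / 2 : ℂ) • bV j = -φ := by
  have hj : ∀ j, qc j (1 / 2 : ℂ) = -a j := fun j => by
    rw [← hAhalf j]
    exact centreValue_eq_neg_of_tube F hPcd (hqa j) (hqm j) (hAd j) (hAc j) (hsrc j)
  simp only [hj, neg_smul, Finset.sum_neg_distrib, hφ]

/-- **THE SPHERICAL LINE (`dim V(χ, K, 1) = 1`, `A ≡ a` constant): `qc z = a·Λ_F(2z−1)∕Λ_F(2z)` on the tube ⟹ `qc(½) = −a`.**  Here the tube letter is exactly road J2′-completed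
(the `χ`-spherical scattering scalar IS the completed ratio times the coordinate `a` of `φ = a·φ°`), with no local [KyS] content. [cite: KeysShahidi1988, Thm. 5.1]
[cite: Rogawski1990, Prop. 11.2.1 pp. 161–162] [cite: Iwaniec2002, Thm. 3.4] -/
theorem centreValue_eq_neg_of_tube_const {qc : ℂ → ℂ} {a : ℂ} {P : Set ℂ} (hPcd : ∀ z₀ : ℂ, ∀ᶠ s in 𝓝[≠] z₀, s ∉ P) (hqa : ∀ z : ℂ, z ∉ P → AnalyticAt ℂ qc z)
    (hqm : MeromorphicNFAt qc (1 / 2 : ℂ)) (hsrc : ∀ z : ℂ, 1 < z.re → qc z = a * (completedDedekindZeta F (2 * z - 1) / completedDedekindZeta F (2 * z))) :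
    qc (1 / 2 : ℂ) = -a :=
  centreValue_eq_neg_of_tube F (A := fun _ => a) hPcd hqa hqm (differentiableOn_const a) continuousWithinAt_const hsrc

/-- **THE SPHERICAL-LINE PRINT OF THE SOCKET'S CONCLUSION**: constant factors `A j ≡ a j` (the `bV`-coordinates of `φ`), tube letters `qc j z = a j·Λ_F(2z−1)∕Λ_F(2z)` ⟹ `∑ j, qc j (1∕2) • bV j = −φ`.
[cite: KeysShahidi1988, Thm. 5.1] [cite: Rogawski1990, Prop. 11.2.1 pp. 161–162] -/
theorem sum_centreValue_smul_eq_neg_of_const {X : Type*} [AddCommGroup X] [Module ℂ X] {ι' : Type*} [Fintype ι'] (bV : ι' → X) {φ : X} (a : ι' → ℂ)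
    (hφ : ∑ j, a j • bV j = φ) (qc : ι' → ℂ → ℂ) {P : Set ℂ} (hPcd : ∀ z₀ : ℂ, ∀ᶠ s in 𝓝[≠] z₀, s ∉ P)
    (hqa : ∀ j (z : ℂ), z ∉ P → AnalyticAt ℂ (qc j) z) (hqm : ∀ j, MeromorphicNFAt (qc j) (1 / 2 : ℂ))
    (hsrc : ∀ j (z : ℂ), 1 < z.re → qc j z = a j * (completedDedekindZeta F (2 * z - 1) / completedDedekindZeta F (2 * z))) :
    ∑ j, qc j (1 / 2 : ℂ) • bV j = -φ :=
  sum_centreValue_smul_eq_neg F bV a hφ qc (fun j _ => a j) hPcd hqa hqm (fun j => differentiableOn_const (a j)) (fun _ => continuousWithinAt_const)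
    (fun _ => rfl) hsrc

/-- **`MeromorphicNFOn qc univ` (clause 4 of the ★ export, as the socket carries it) gives the normal form AT `½`.** [folklore] -/
theorem meromorphicNFAt_half_of_meromorphicNFOn_univ {qc : ℂ → ℂ} (h : MeromorphicNFOn qc univ) : MeromorphicNFAt qc (1 / 2 : ℂ) :=
  h (mem_univ _)

/-! ### The CM print `F = L⁺` -/

section CM

variable (L : Type) [Field L] [NumberField L]

/-- **THE `U(1,1)_{L∕L⁺}` PRINT**: with `F := L⁺ = maximalRealSubfield L` (totally real, `r₂ = 0`), for every finite family `bV`, `φ = ∑ a j • bV j`, and continued coordinates `qc j` with the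
socket's clauses `MeromorphicNFOn (qc j) univ`, analytic off the co-discrete `P`, and the tube letters in completed-`Λ_{L⁺}` currency with `A j (½) = a j`:  `∑ j, qc j (1∕2) • bV j = −φ` — the
conclusion of `sock_S8_ext_kysCentreU2` for the self-dual `χ` with `χ|C_{L⁺} = 1`. [cite: KeysShahidi1988, Thm. 5.1] [cite: Rogawski1990, Prop. 11.2.1 pp. 161–162] -/
theorem sum_centreValue_smul_eq_neg_cm {X : Type*} [AddCommGroup X] [Module ℂ X] {ι' : Type*} [Fintype ι'] (bV : ι' → X) {φ : X} (a : ι' → ℂ)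
    (hφ : ∑ j, a j • bV j = φ) (qc A : ι' → ℂ → ℂ) {P : Set ℂ} (hPcd : ∀ z₀ : ℂ, ∀ᶠ s in 𝓝[≠] z₀, s ∉ P)
    (hqa : ∀ j (z : ℂ), z ∉ P → AnalyticAt ℂ (qc j) z) (hqNF : ∀ j, MeromorphicNFOn (qc j) univ)
    (hAd : ∀ j, DifferentiableOn ℂ (A j) {z : ℂ | 1 / 2 < z.re}) (hAc : ∀ j, ContinuousWithinAt (A j) {z : ℂ | 1 / 2 < z.re} (1 / 2 : ℂ)) (hAhalf : ∀ j, A j (1 / 2 : ℂ) = a j)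
    (hsrc : ∀ j (z : ℂ), 1 < z.re →
      qc j z = A j z * (completedDedekindZeta ↥(maximalRealSubfield L) (2 * z - 1) / completedDedekindZeta ↥(maximalRealSubfield L) (2 * z))) :
    ∑ j, qc j (1 / 2 : ℂ) • bV j = -φ :=
  sum_centreValue_smul_eq_neg ↥(maximalRealSubfield L) bV a hφ qc A hPcd hqa (fun j => hqNF j (mem_univ _)) hAd hAc hAhalf hsrc

end CM

end Summit.HodgeConjecture.HodgeConjecture.Cruxes.H413.K2E1IntertwiningScalarCentreValueU2

end
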